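/-
Copyright: the b2b-balaban T⁴-continuum CRUX team, row NE7b owner lineage `t4-ne7b-p1` (gen 116). Project licence.
-/
import Summits.QuantumFields.BalabanUV.T4Continuum.Spine.NE7b.SupSmallFieldBackground
import Summits.QuantumFields.BalabanUV.T4Continuum.Spine.NE7b.OneShotChartSupGradient
import Summits.QuantumFields.BalabanUV.T4Continuum.Spine.NE7b.BlockPropagatorSupGradient

/-!
# THE SUP CHART CONTROLS THE BLOCK-SCALE GRADIENT OF EVERY BOUNDED FIELD — `‖∇_μ φ‖_∞ ≤ (n+1)⁻¹·(C_∞‖Q′φ‖_∞ + C_Γ′‖P(Aφ)‖_∞)` on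
# `ℓ^∞(ℤ^d)`, `d ≥ 3`, EVERY side, ONE pair of constants — hence THE INTERACTING BACKGROUND OF (60), ITS RESPONSE AND ITS FLUCTUATION
# COVARIANCE ARE SMOOTH AT THE BLOCK SCALE: `‖∇(σ w)‖_∞ ≤ (n+1)⁻¹·(C_∞ + 2λK₁C_Γ′)·‖w‖_∞` (the η-gradient letter `‖∇^η σ(w)‖_∞ ≤ C‖w‖_∞`,
# mesh-free) (row NE7b, node U5c; ASE ∕ (47) ∕ (50) ∕ (51) ∕ (60) BY NAME; [folklore])

Cell `pub-balaban`, sub-cell `t4`, spine estimate NE7b (`T4WeightBudget.RelWeightBound`; the cell's OWN estimate — NOT PRINTED in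
[Bałaban 1983–89], NOT PROVED).  Crux-route work under `Spine/NE7b/` by the row OWNER (`t4-ne7b-p1` gen 116) under FREEZE (0)'s
crux-prover clause (FILING-CLAIM C-ne7bp1-g116-1); NOTHING of Bałaban's is named, valued or asserted; no `T4Continuum/Support` leaf
typed; no `def`, no notation; zero `sorry`.  Imports (BY NAME): the owner's (60) `…SupSmallFieldBackground` (`exists_background`; through
it leaf-06's (57) `…AugmentedSupEquivalence` — `exists_aug_equiv_sup`, the chart `T h = (Q′h, P(Ah))` with `T⁻¹(w,κ) = Hw + Γκ` written
out —, (51) `…FibreInverseSupNorm` (`abs_Gop_le`, `abs_blockAvg_Gop_le`), (58) `…LocalNemytskiiSup` (`abs_comp_le`)), (47)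
`…OneShotChartSupGradient` (`abs_HBZd_diff_le_sup`: `‖∇(H_M B)‖_∞ ≤ C_∞M⁻¹‖B‖_∞`) and (50) `…BlockPropagatorSupGradient`
(`exists_gradient_letter_Gk`: `‖∇(G′f)‖_∞ ≤ A′M⁻¹‖f‖_∞`, ONE `A′` for every side).

WHY (located).  Print's small-field REGIONS are pointwise conditions on the fields AND THEIR LATTICE DERIVATIVES at the current scale
([B5] (1.65) `|H_k(x,y)|, |∂H_k(x,y)| ≤ O(1)e^{−δ|x−y|}`; [B15] p. 177 (i)–(ii); Dimock I Lemma 31), and the background configurations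
entering (1.89)'s sup form are the INTERACTING ones.  (47) ∕ (50) typed the η-gradient letters of the FREE skeleton (`H`, `G′`); (60) ∕
(61) ∕ (63) gave the interacting background `σ(w)`, its response `Dσ(w)` and the fluctuation covariance `C̃(w)` in the sup norm with
VALUE letters only.  The gradient letters follow from one observation: ASE's chart is an equivalence, so EVERY `φ ∈ ℓ^∞` IS
`T⁻¹(Q′φ, P(Aφ)) = H(Q′φ) + Γ(P(Aφ))`, and `H`, `Γ = G′ − H(Q′G′·)` have gradients one factor `(n+1)⁻¹` smaller than their values
((47), (50)).  So `|φ(p+e_μ) − φ(p)| ≤ (n+1)⁻¹·(C_∞‖Q′φ‖ + C_Γ′‖P(Aφ)‖)` for every bounded field (§2) — a block-scale interior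
regularity statement with the SAME two constants at every side —, and each object of the interacting column is a field whose `Q′`-
and `P∘A`-images are controlled by its own equation: the background (`Q′σw = w`, `P(Aσw) = −P(u∘σw)`, `‖P(u∘σw)‖ ≤ 2λ‖σw‖`), the
response and the covariance (`P(Ah) = κ₀ − P(N′h)`, `‖N′‖ ≤ λ`) (§3).  No new analysis: (47) + (50) + ASE's formula.

WHAT IS PROVED ([folklore]; `ℓ^∞ := lp (fun _ : X d => ℝ) ∞`; `C_∞ := cHs·K_d(δ_H)`, `C_G := A_G·K_d(δ_u∕4)` written out, `A′` the
gradient constant of (50), `C_Γ′ := A′ + C_∞·C_G`):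
* §1 (sitewise, bounded data) `tsum_Gk_mul_diff_eq`; **`abs_fibreInverse_diff_le`** (`|(Γψ)(p+e_μ) − (Γψ)(p)| ≤ (n+1)⁻¹·C_Γ′·R_ψ`);
  **`abs_augInverse_diff_le`** (`φ = Hk + Γψ`: `|φ(p+e_μ) − φ(p)| ≤ (n+1)⁻¹·(C_∞R_k + C_Γ′R_ψ)` — the gradient half of (51)
  `augInverse_letters`).
* §2 **`exists_chart_gradient`** — `d ≥ 3`, `a > 0`: `∃ A′ ≥ 0, ∀ n, ∃ Q′ A P` (actions displayed, `‖Q′‖ ≤ 1`, `‖P‖ ≤ 2`) with, for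
  EVERY `φ ∈ ℓ^∞`, `p`, `μ`: `|φ(p+e_μ) − φ(p)| ≤ (n+1)⁻¹·(C_∞‖Q′φ‖ + C_Γ′‖P(Aφ)‖)`.
* §3 readers of §2's letter (generic in the two constants): `abs_diff_le_of_fibre_eq` (`P(Aφ + g) = κ₀` ⟹ `≤ (n+1)⁻¹·(C_∞‖Q′φ‖ +
  C_Γ′(‖κ₀‖ + 2‖g‖))` — the response `Dσ(w)v` (`g = N′(σw)(Dσ(w)v)`, `κ₀ = 0`, (63) §2 ∕ SISL (b)) and the covariance `C̃(w)f`
  (`Q′h = 0`, `κ₀ = Pf`, (60) v1.1 §4) are instances); `norm_fibreProj_A_le_of_background_eq` + **`abs_diff_le_of_background_eq`**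
  (the sitewise background system «`Aφ + u∘φ` equals its block average», `|u t| ≤ λ|t|` ⟹ `‖P(Aφ)‖ ≤ 2λ‖φ‖` and
  `|φ(p+e_μ) − φ(p)| ≤ (n+1)⁻¹·(C_∞‖Q′φ‖ + 2λC_Γ′‖φ‖)`).
* §4 **`exists_background_gradient`** — (60) `exists_background` RE-EXPORTED for every side under ONE `A′` with the new clause: on
  `‖w‖ ≤ (N⁻¹ − c)r`, `|σw(p+e_μ) − σw(p)| ≤ (n+1)⁻¹·(C_∞ + 2λ(N⁻¹ − c)⁻¹C_Γ′)·‖w‖` — THE INTERACTING BACKGROUND IS SMOOTH AT THE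
  BLOCK SCALE, mesh-free (`‖∇^η σ(w)‖_∞ ≤ C‖w‖_∞` in `η = (n+1)⁻¹` units).
* §5 toy.

HONEST (what this is NOT).  Forward differences only; constants existential and useless by value (as (46)–(51)); no second
differences (third differences of the lattice Green function are not in the tree); no weighted ∕ two-radius (region) form of the
gradient letter (the weighted rows of (62) have no gradient twin yet); scalar `ℤ^d` skeleton with a sitewise interaction — nothing of the
covariant `H_k`, axial gauge, (A3) ∕ (A1c) (NC-NE7b-α UNRULED).  BY-NAME EFFECT ON THE WALL: NONE.  NE7b NOT PRINTED ∕ NOT PROVED;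
spine PROVED 0∕9; rung (B)+1 on a FINITE torus — NOT infinite volume, NOT the mass gap, NOT Clay.  HONEST DEPENDENCY: continuum YM on
T⁴ ⇐ BetaPertH ∧ nine spine estimates (0∕9 proved); BetaPertH ⇐ (D1) ∧ (D4) ∧ CAP+tail; G-an2-4 gates asym, D1 and NE2∕3∕4.
-/

set_option autoImplicit false

noncomputable section

namespace Summit.QuantumFields.BalabanUV.T4Continuum.NE7b.SupBackgroundGradient

open scoped ENNReal NNReal
open Metric Set
open Literature.MathematicalPhysics.QuantumFieldTheory.Balaban1983to89
open B4Sect5Proof (latticeConst latticeConst_nonneg)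
open B6QGQLower276 (X e blk B mem_B sum_B_const AX)
open B6QGQDecay237 (deltaU deltaU_pos)
open B5Hk103ScalarZd (Gk nbhd deltaH deltaH_pos)
open B5Hk165L2Zd (HBZd)
open Summit.QuantumFields.BalabanUV.Beta.D1BFx.BlockColumnSupNorm (cHs cHs_nonneg)
open Summit.QuantumFields.BalabanUV.Beta.D1BFx.PointColumnSplit (cKL cG0 cSplit)
open Summit.QuantumFields.BalabanUV.Beta.D1BFx.PointColumnDecay (cFar)
open OneShotChartSupNorm (abs_HBZd_le_sup nonneg_of_abs_le)
open OneShotChartSupOperator (abs_apply_le_norm)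
open OneShotChartSupGradient (abs_HBZd_diff_le_sup)
open BlockPropagatorSupNorm (summable_Gk_mul_of_bounded supConstG_nonneg)
open BlockPropagatorSupGradient (exists_gradient_letter_Gk)
open FibreInverseSupNorm (abs_Gop_le abs_blockAvg_Gop_le abs_blockAvg_le)
open LocalNemytskiiSup (abs_comp_le)
open AugmentedSupEquivalence (exists_aug_equiv_sup)
open SupSmallFieldBackground (exists_background)

variable {d : ℕ}

/-! ## §1. Sitewise: the gradient of the fibre inverse and of `Hk + Γψ` -/

/-- The forward difference of `G′f` for bounded `f` is the series of the kernel's forward differences (every `d`). [folklore] -/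
theorem tsum_Gk_mul_diff_eq (n : ℕ) {a : ℝ} (ha : 0 < a) {f : X d → ℝ} {R : ℝ} (hf : ∀ q, |f q| ≤ R)
    (p : X d) (μ : Fin d) :
    (∑' q : X d, Gk n a (p + e μ) q * f q) - (∑' q : X d, Gk n a p q * f q)
      = ∑' q : X d, (Gk n a (p + e μ) q - Gk n a p q) * f q := by
  rw [← (summable_Gk_mul_of_bounded n ha hf (p + e μ)).tsum_sub (summable_Gk_mul_of_bounded n ha hf p)]
  exact tsum_congr fun q => by ring

/-- **THE GRADIENT OF THE FIBRE INVERSE** `Γψ = G′ψ − H(Q′G′ψ)` on bounded data (`d ≥ 3`), given the gradient letter of `G′` at this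
side with constant `A′` ((50) supplies one `A′` for every side): `|(Γψ)(p+e_μ) − (Γψ)(p)| ≤ (n+1)⁻¹·(A′ + C_∞·C_G)·R_ψ`. [folklore] -/
theorem abs_fibreInverse_diff_le (hd : 3 ≤ d) (n : ℕ) {a : ℝ} (ha : 0 < a) {A' : ℝ}
    (hA' : ∀ (p : X d) (μ : Fin d) (f : X d → ℝ) (R : ℝ), (∀ q, |f q| ≤ R) →
      |∑' q : X d, (Gk n a (p + e μ) q - Gk n a p q) * f q| ≤ A' / ((n : ℝ) + 1) * R)
    {ψ : X d → ℝ} {R : ℝ} (hψ : ∀ q, |ψ q| ≤ R) (p : X d) (μ : Fin d) :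
    |((∑' q : X d, Gk n a (p + e μ) q * ψ q)
        - HBZd n a (fun y => (((n : ℝ) + 1) ^ d)⁻¹ * ∑ p' ∈ B n y, ∑' q : X d, Gk n a p' q * ψ q) (p + e μ))
      - ((∑' q : X d, Gk n a p q * ψ q)
        - HBZd n a (fun y => (((n : ℝ) + 1) ^ d)⁻¹ * ∑ p' ∈ B n y, ∑' q : X d, Gk n a p' q * ψ q) p)|
      ≤ (A' + cHs d a * latticeConst d (deltaH d a)
            * (((cG0 d * cKL d (d - 2) + cSplit d a) * Real.exp (2 * deltaU d a)
                + cFar d a * Real.exp (4 * deltaU d a) / deltaU d a ^ 2) * latticeConst d (deltaU d a / 4)))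
          / ((n : ℝ) + 1) * R := by
  have hG : ∀ p, |∑' q : X d, Gk n a p q * ψ q| ≤ _ := fun p => abs_Gop_le hd n ha hψ p
  have hQG := abs_blockAvg_Gop_le n hG
  have h1 : |(∑' q : X d, Gk n a (p + e μ) q * ψ q) - (∑' q : X d, Gk n a p q * ψ q)| ≤ A' / ((n : ℝ) + 1) * R := by
    rw [tsum_Gk_mul_diff_eq n ha hψ p μ]; exact hA' p μ ψ R hψ
  have h2 := abs_HBZd_diff_le_sup hd n ha hQG p μ
  have hre : ((∑' q : X d, Gk n a (p + e μ) q * ψ q)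
        - HBZd n a (fun y => (((n : ℝ) + 1) ^ d)⁻¹ * ∑ p' ∈ B n y, ∑' q : X d, Gk n a p' q * ψ q) (p + e μ))
      - ((∑' q : X d, Gk n a p q * ψ q)
        - HBZd n a (fun y => (((n : ℝ) + 1) ^ d)⁻¹ * ∑ p' ∈ B n y, ∑' q : X d, Gk n a p' q * ψ q) p)
      = ((∑' q : X d, Gk n a (p + e μ) q * ψ q) - (∑' q : X d, Gk n a p q * ψ q))
        - (HBZd n a (fun y => (((n : ℝ) + 1) ^ d)⁻¹ * ∑ p' ∈ B n y, ∑' q : X d, Gk n a p' q * ψ q) (p + e μ)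
          - HBZd n a (fun y => (((n : ℝ) + 1) ^ d)⁻¹ * ∑ p' ∈ B n y, ∑' q : X d, Gk n a p' q * ψ q) p) := by ring
  rw [hre]
  calc _ ≤ |(∑' q : X d, Gk n a (p + e μ) q * ψ q) - (∑' q : X d, Gk n a p q * ψ q)|
        + |HBZd n a (fun y => (((n : ℝ) + 1) ^ d)⁻¹ * ∑ p' ∈ B n y, ∑' q : X d, Gk n a p' q * ψ q) (p + e μ)
          - HBZd n a (fun y => (((n : ℝ) + 1) ^ d)⁻¹ * ∑ p' ∈ B n y, ∑' q : X d, Gk n a p' q * ψ q) p| := abs_sub _ _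
    _ ≤ _ := add_le_add h1 h2
    _ = _ := by ring

/-- **THE GRADIENT OF THE AUGMENTED INVERSE** `φ = Hk + Γψ` on bounded data (`d ≥ 3`; the gradient half of (51) `augInverse_letters`):
`|φ(p+e_μ) − φ(p)| ≤ (n+1)⁻¹·(C_∞·R_k + (A′ + C_∞·C_G)·R_ψ)`. [folklore] -/
theorem abs_augInverse_diff_le (hd : 3 ≤ d) (n : ℕ) {a : ℝ} (ha : 0 < a) {A' : ℝ}
    (hA' : ∀ (p : X d) (μ : Fin d) (f : X d → ℝ) (R : ℝ), (∀ q, |f q| ≤ R) →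
      |∑' q : X d, (Gk n a (p + e μ) q - Gk n a p q) * f q| ≤ A' / ((n : ℝ) + 1) * R)
    {k ψ : X d → ℝ} {Rk Rψ : ℝ} (hk : ∀ y, |k y| ≤ Rk) (hψ : ∀ q, |ψ q| ≤ Rψ) (p : X d) (μ : Fin d) :
    |(HBZd n a k (p + e μ) + ((∑' q : X d, Gk n a (p + e μ) q * ψ q)
        - HBZd n a (fun y => (((n : ℝ) + 1) ^ d)⁻¹ * ∑ p' ∈ B n y, ∑' q : X d, Gk n a p' q * ψ q) (p + e μ)))
      - (HBZd n a k p + ((∑' q : X d, Gk n a p q * ψ q)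
        - HBZd n a (fun y => (((n : ℝ) + 1) ^ d)⁻¹ * ∑ p' ∈ B n y, ∑' q : X d, Gk n a p' q * ψ q) p))|
      ≤ ((n : ℝ) + 1)⁻¹ * (cHs d a * latticeConst d (deltaH d a) * Rk
          + (A' + cHs d a * latticeConst d (deltaH d a)
              * (((cG0 d * cKL d (d - 2) + cSplit d a) * Real.exp (2 * deltaU d a)
                  + cFar d a * Real.exp (4 * deltaU d a) / deltaU d a ^ 2) * latticeConst d (deltaU d a / 4))) * Rψ) := by
  have h1 := abs_HBZd_diff_le_sup hd n ha hk p μ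
  have h2 := abs_fibreInverse_diff_le hd n ha hA' hψ p μ
  rw [add_sub_add_comm]
  calc _ ≤ _ := abs_add_le _ _
    _ ≤ _ := add_le_add h1 h2
    _ = _ := by ring

/-! ## §2. Operator level: every bounded field is `H(Q′φ) + Γ(P(Aφ))` -/

/-- **THE SUP CHART CONTROLS THE BLOCK-SCALE GRADIENT OF EVERY BOUNDED FIELD** (`d ≥ 3`, `a > 0`): there is ONE `A′ ≥ 0` such
that for EVERY side `n + 1` the skeleton's operators `Q′`, `A`, `P = 1 − Q′*Q′` (actions displayed, `‖Q′‖ ≤ 1`, `‖P‖ ≤ 2`) satisfy,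
for every `φ ∈ ℓ^∞(ℤ^d)`, `p`, `μ`:
`|φ(p+e_μ) − φ(p)| ≤ (n+1)⁻¹·(C_∞‖Q′φ‖ + (A′ + C_∞C_G)‖P(Aφ)‖)` — because `φ = T⁻¹(Q′φ, P(Aφ)) = H(Q′φ) + Γ(P(Aφ))` (ASE) and
§1. [folklore] -/
theorem exists_chart_gradient (hd : 3 ≤ d) {a : ℝ} (ha : 0 < a) :
    ∃ A' : ℝ, 0 ≤ A' ∧ ∀ n : ℕ,
      ∃ (Dop Aop Pop : lp (fun _ : X d => ℝ) ∞ →L[ℝ] lp (fun _ : X d => ℝ) ∞),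
        (∀ (f : lp (fun _ : X d => ℝ) ∞) (y : X d), Dop f y = (((n : ℝ) + 1) ^ d)⁻¹ * ∑ p ∈ B n y, f p) ∧
        (∀ (f : lp (fun _ : X d => ℝ) ∞) (p : X d), Aop f p = ∑ r ∈ nbhd n p, AX n a p r * f r) ∧
        (∀ (f : lp (fun _ : X d => ℝ) ∞) (p : X d),
          Pop f p = f p - (((n : ℝ) + 1) ^ d)⁻¹ * ∑ p' ∈ B n (blk n p), f p') ∧
        ‖Dop‖ ≤ 1 ∧ ‖Pop‖ ≤ 2 ∧
        ∀ (φ : lp (fun _ : X d => ℝ) ∞) (p : X d) (μ : Fin d),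
          |φ (p + e μ) - φ p|
            ≤ ((n : ℝ) + 1)⁻¹ * (cHs d a * latticeConst d (deltaH d a) * ‖Dop φ‖
                + (A' + cHs d a * latticeConst d (deltaH d a)
                    * (((cG0 d * cKL d (d - 2) + cSplit d a) * Real.exp (2 * deltaU d a)
                        + cFar d a * Real.exp (4 * deltaU d a) / deltaU d a ^ 2) * latticeConst d (deltaU d a / 4)))
                  * ‖Pop (Aop φ)‖) := by
  obtain ⟨A', hA0, hA'⟩ := exists_gradient_letter_Gk hd ha
  refine ⟨A', hA0, fun n => ?_⟩
  obtain ⟨Dop, Aop, Pop, hD, hA, hP, hDn, hPn, Rop, hR, T, hT, hsymm, -⟩ := exists_aug_equiv_sup hd n ha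
  refine ⟨Dop, Aop, Pop, hD, hA, hP, hDn, hPn, fun φ p μ => ?_⟩
  have hφ : T.symm (Dop φ, Rop φ) = φ := by rw [← hT φ, ContinuousLinearEquiv.symm_apply_apply]
  have hpt : ∀ q : X d, φ q
      = HBZd n a (Dop φ) q + ((∑' q' : X d, Gk n a q q' * (Pop (Aop φ)) q')
          - HBZd n a (fun y => (((n : ℝ) + 1) ^ d)⁻¹ * ∑ p' ∈ B n y,
              ∑' q' : X d, Gk n a p' q' * (Pop (Aop φ)) q') q) := fun q => by
    have h1 : φ q = (T.symm (Dop φ, Rop φ) : lp (fun _ : X d => ℝ) ∞) q := by rw [hφ]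
    rw [h1, hsymm, hR]
  rw [hpt (p + e μ), hpt p]
  exact abs_augInverse_diff_le hd n ha (hA' n) (abs_apply_le_norm (Dop φ)) (abs_apply_le_norm (Pop (Aop φ))) p μ

/-! ## §3. Readers: fields pinned by a fibre equation; the sitewise background system -/

section Readers

variable {n : ℕ} {CH CG : ℝ} {Dop Aop Pop : lp (fun _ : X d => ℝ) ∞ →L[ℝ] lp (fun _ : X d => ℝ) ∞}

/-- **GRADIENT OF A FIELD PINNED BY A FIBRE EQUATION**: under §2's letter with constants `(C_H, C_Γ′)`, `C_Γ′ ≥ 0`, `‖P‖ ≤ 2`, a field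
with `P(Aφ + g) = κ₀` obeys `|φ(p+e_μ) − φ(p)| ≤ (n+1)⁻¹·(C_H‖Q′φ‖ + C_Γ′(‖κ₀‖ + 2‖g‖))`.  Instances: the response `h = Dσ(w)v`
(`Q′h = v`, `g = N′(σw)h`, `κ₀ = 0`), the fluctuation covariance `h = C̃(w)f` (`Q′h = 0`, `g = N′(σw)h`, `κ₀ = Pf`). [folklore] -/
theorem abs_diff_le_of_fibre_eq (hCG : 0 ≤ CG) (hPn : ‖Pop‖ ≤ 2)
    (hgrad : ∀ (φ : lp (fun _ : X d => ℝ) ∞) (p : X d) (μ : Fin d),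
      |φ (p + e μ) - φ p| ≤ ((n : ℝ) + 1)⁻¹ * (CH * ‖Dop φ‖ + CG * ‖Pop (Aop φ)‖))
    {φ g κ₀ : lp (fun _ : X d => ℝ) ∞} (hfib : Pop (Aop φ + g) = κ₀) (p : X d) (μ : Fin d) :
    |φ (p + e μ) - φ p| ≤ ((n : ℝ) + 1)⁻¹ * (CH * ‖Dop φ‖ + CG * (‖κ₀‖ + 2 * ‖g‖)) := by
  have hPA : Pop (Aop φ) = κ₀ - Pop g := by rw [← hfib, map_add, add_sub_cancel_right]
  have hb : ‖Pop (Aop φ)‖ ≤ ‖κ₀‖ + 2 * ‖g‖ := by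
    rw [hPA]
    exact (norm_sub_le _ _).trans (add_le_add le_rfl
      ((Pop.le_opNorm g).trans (mul_le_mul_of_nonneg_right hPn (norm_nonneg g))))
  have hM : (0 : ℝ) ≤ ((n : ℝ) + 1)⁻¹ := by positivity
  exact (hgrad φ p μ).trans (mul_le_mul_of_nonneg_left (add_le_add le_rfl (mul_le_mul_of_nonneg_left hb hCG)) hM)

/-- **`‖P(Aφ)‖ ≤ 2λ‖φ‖` FOR A SOLUTION OF THE SITEWISE BACKGROUND SYSTEM** («`Aφ + u∘φ` equals its own block average at every site»,
`|u t| ≤ λ|t|`): `P(Aφ)(q) = Q′(u∘φ)(blk q) − u(φ q)`. [folklore] -/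
theorem norm_fibreProj_A_le_of_background_eq
    (hP : ∀ (f : lp (fun _ : X d => ℝ) ∞) (p : X d), Pop f p = f p - (((n : ℝ) + 1) ^ d)⁻¹ * ∑ p' ∈ B n (blk n p), f p')
    {u : ℝ → ℝ} {lam : ℝ} (hlam : 0 ≤ lam) (hu : ∀ t, |u t| ≤ lam * |t|) {φ : lp (fun _ : X d => ℝ) ∞}
    (hEL : ∀ p : X d, Aop φ p + u (φ p)
      = (((n : ℝ) + 1) ^ d)⁻¹ * ∑ p' ∈ B n (blk n p), (Aop φ p' + u (φ p'))) :
    ‖Pop (Aop φ)‖ ≤ 2 * lam * ‖φ‖ := by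
  have huφ : ∀ q, |u (φ q)| ≤ lam * ‖φ‖ := fun q =>
    (hu (φ q)).trans (mul_le_mul_of_nonneg_left (abs_apply_le_norm φ q) hlam)
  refine lp.norm_le_of_forall_le (by positivity) fun q => ?_
  have hq : Pop (Aop φ) q = (((n : ℝ) + 1) ^ d)⁻¹ * ∑ p' ∈ B n (blk n q), u (φ p') - u (φ q) := by
    rw [hP]
    have h := hEL q
    rw [Finset.sum_add_distrib, mul_add] at h
    linarith
  rw [Real.norm_eq_abs, hq]
  calc _ ≤ |(((n : ℝ) + 1) ^ d)⁻¹ * ∑ p' ∈ B n (blk n q), u (φ p')| + |u (φ q)| := abs_sub _ _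
    _ ≤ lam * ‖φ‖ + lam * ‖φ‖ := add_le_add (abs_blockAvg_le n (fun p' => huφ p') (blk n q)) (huφ q)
    _ = 2 * lam * ‖φ‖ := by ring

/-- **GRADIENT OF A SOLUTION OF THE BACKGROUND SYSTEM**: under §2's letter with constants `(C_H, C_Γ′)`, `C_Γ′ ≥ 0`, every bounded
field `φ` for which `Aφ + u∘φ` is block-constant (`|u t| ≤ λ|t|`) — in particular (60)'s `σ w`, `Q′(σw) = w` — obeys
`|φ(p+e_μ) − φ(p)| ≤ (n+1)⁻¹·(C_H‖Q′φ‖ + C_Γ′·2λ‖φ‖)`. [folklore] -/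
theorem abs_diff_le_of_background_eq (hCG : 0 ≤ CG)
    (hP : ∀ (f : lp (fun _ : X d => ℝ) ∞) (p : X d), Pop f p = f p - (((n : ℝ) + 1) ^ d)⁻¹ * ∑ p' ∈ B n (blk n p), f p')
    (hgrad : ∀ (φ : lp (fun _ : X d => ℝ) ∞) (p : X d) (μ : Fin d),
      |φ (p + e μ) - φ p| ≤ ((n : ℝ) + 1)⁻¹ * (CH * ‖Dop φ‖ + CG * ‖Pop (Aop φ)‖))
    {u : ℝ → ℝ} {lam : ℝ} (hlam : 0 ≤ lam) (hu : ∀ t, |u t| ≤ lam * |t|) {φ : lp (fun _ : X d => ℝ) ∞}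
    (hEL : ∀ p : X d, Aop φ p + u (φ p)
      = (((n : ℝ) + 1) ^ d)⁻¹ * ∑ p' ∈ B n (blk n p), (Aop φ p' + u (φ p'))) (p : X d) (μ : Fin d) :
    |φ (p + e μ) - φ p| ≤ ((n : ℝ) + 1)⁻¹ * (CH * ‖Dop φ‖ + CG * (2 * lam * ‖φ‖)) := by
  have hM : (0 : ℝ) ≤ ((n : ℝ) + 1)⁻¹ := by positivity
  exact (hgrad φ p μ).trans (mul_le_mul_of_nonneg_left (add_le_add le_rfl
    (mul_le_mul_of_nonneg_left (norm_fibreProj_A_le_of_background_eq hP hlam hu hEL) hCG)) hM)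

end Readers

/-! ## §4. (60) re-exported with the gradient letter: the interacting background is smooth at the block scale -/

/-- Two operators on `ℓ^∞` with the same displayed action are equal. [folklore] -/
theorem clm_eq_of_apply_eq {T T' : lp (fun _ : X d => ℝ) ∞ →L[ℝ] lp (fun _ : X d => ℝ) ∞}
    (h : ∀ (f : lp (fun _ : X d => ℝ) ∞) (p : X d), T f p = T' f p) : T = T' :=
  ContinuousLinearMap.ext fun f => lp.ext (funext fun p => h f p)

/-- **THE SMALL-FIELD BACKGROUND OF THE PERTURBED GAUSSIAN SKELETON IS SMOOTH AT THE BLOCK SCALE** (`d ≥ 3`, `a > 0`, data as in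
(60): `u 0 = 0`, `|u′| ≤ λ`, `u′` `L`-Lipschitz, `N ≥ N_∞`, `2λ ≤ c < N⁻¹`, `r ≥ 0`): there is ONE `A′ ≥ 0` such that FOR EVERY SIDE
`n + 1`, (60) `exists_background`'s operators `Q′, A, P` and background map `σ` exist with all of (60)'s letters AND, on
`‖w‖ ≤ (N⁻¹ − c)·r`, for every `p`, `μ`:
`|σw(p+e_μ) − σw(p)| ≤ (n+1)⁻¹·(C_∞ + (A′ + C_∞C_G)·(2λ(N⁻¹ − c)⁻¹))·‖w‖` — `‖∇^η σ(w)‖_∞ ≤ C‖w‖_∞`, mesh-free. [folklore] -/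
theorem exists_background_gradient (hd : 3 ≤ d) {a : ℝ} (ha : 0 < a)
    {u u' : ℝ → ℝ} (hu : ∀ t, HasDerivAt u (u' t) t) (hu0 : u 0 = 0) {lam c N : ℝ≥0} (hlam : ∀ t, |u' t| ≤ lam)
    {L : ℝ} (hL0 : 0 ≤ L) (hL : ∀ s t, |u' s - u' t| ≤ L * |s - t|)
    (hN : cHs d a * latticeConst d (deltaH d a)
        + ((cG0 d * cKL d (d - 2) + cSplit d a) * Real.exp (2 * deltaU d a)
            + cFar d a * Real.exp (4 * deltaU d a) / deltaU d a ^ 2) * latticeConst d (deltaU d a / 4)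
          * (1 + cHs d a * latticeConst d (deltaH d a)) ≤ (N : ℝ))
    (hc : 2 * lam ≤ c) (hcN : c < N⁻¹) {r : ℝ} (hr : 0 ≤ r) :
    ∃ A' : ℝ, 0 ≤ A' ∧ ∀ n : ℕ,
    ∃ (Dop Aop Pop : lp (fun _ : X d => ℝ) ∞ →L[ℝ] lp (fun _ : X d => ℝ) ∞)
      (σ : lp (fun _ : X d => ℝ) ∞ → lp (fun _ : X d => ℝ) ∞),
      (∀ (f : lp (fun _ : X d => ℝ) ∞) (y : X d), Dop f y = (((n : ℝ) + 1) ^ d)⁻¹ * ∑ p ∈ B n y, f p) ∧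
      (∀ (f : lp (fun _ : X d => ℝ) ∞) (p : X d), Aop f p = ∑ r ∈ nbhd n p, AX n a p r * f r) ∧
      (∀ (f : lp (fun _ : X d => ℝ) ∞) (p : X d), Pop f p = f p - (((n : ℝ) + 1) ^ d)⁻¹ * ∑ p' ∈ B n (blk n p), f p') ∧
      σ 0 = 0 ∧
      (∀ w ∈ closedBall (0 : lp (fun _ : X d => ℝ) ∞) (((N : ℝ)⁻¹ - c) * r),
        σ w ∈ closedBall 0 r ∧ Dop (σ w) = w ∧
          ∀ p : X d, Aop (σ w) p + u (σ w p)
            = (((n : ℝ) + 1) ^ d)⁻¹ * ∑ p' ∈ B n (blk n p), (Aop (σ w) p' + u (σ w p'))) ∧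
      LipschitzOnWith (N⁻¹ - c)⁻¹ σ (closedBall (0 : lp (fun _ : X d => ℝ) ∞) (((N : ℝ)⁻¹ - c) * r)) ∧
      (∀ φ ∈ closedBall (0 : lp (fun _ : X d => ℝ) ∞) r,
        (∀ p : X d, Aop φ p + u (φ p) = (((n : ℝ) + 1) ^ d)⁻¹ * ∑ p' ∈ B n (blk n p), (Aop φ p' + u (φ p'))) →
          σ (Dop φ) = φ) ∧
      (∀ w ∈ ball (0 : lp (fun _ : X d => ℝ) ∞) (((N : ℝ)⁻¹ - c) * r),
        DifferentiableAt ℝ σ w ∧ ‖fderiv ℝ σ w‖ ≤ ((N : ℝ)⁻¹ - c)⁻¹ ∧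
          Dop.comp (fderiv ℝ σ w) = ContinuousLinearMap.id ℝ (lp (fun _ : X d => ℝ) ∞)) ∧
      (∀ w ∈ closedBall (0 : lp (fun _ : X d => ℝ) ∞) (((N : ℝ)⁻¹ - c) * r), ∀ (p : X d) (μ : Fin d),
        |σ w (p + e μ) - σ w p|
          ≤ ((n : ℝ) + 1)⁻¹ * (cHs d a * latticeConst d (deltaH d a)
              + (A' + cHs d a * latticeConst d (deltaH d a)
                  * (((cG0 d * cKL d (d - 2) + cSplit d a) * Real.exp (2 * deltaU d a)
                      + cFar d a * Real.exp (4 * deltaU d a) / deltaU d a ^ 2) * latticeConst d (deltaU d a / 4)))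
                * (2 * lam * ((N : ℝ)⁻¹ - c)⁻¹)) * ‖w‖) := by
  obtain ⟨A', hA0, hgradAll⟩ := exists_chart_gradient hd ha
  refine ⟨A', hA0, fun n => ?_⟩
  obtain ⟨Dop, Aop, Pop, hD, hA, hP, -, -, hgrad⟩ := hgradAll n
  obtain ⟨Dop', Aop', Pop', σ, hD', hA', hP', hσ0, hσ, hlip, huniq, hderiv⟩ :=
    exists_background hd n ha hu hu0 hlam hL0 hL hN hc hcN hr
  have eD : Dop' = Dop := clm_eq_of_apply_eq fun f p => by rw [hD, hD']
  have eA : Aop' = Aop := clm_eq_of_apply_eq fun f p => by rw [hA, hA']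
  have eP : Pop' = Pop := clm_eq_of_apply_eq fun f p => by rw [hP, hP']
  subst eD eA eP
  refine ⟨Dop', Aop', Pop', σ, hD', hA', hP', hσ0, hσ, hlip, huniq, hderiv, fun w hw p μ => ?_⟩
  have hCH0 : 0 ≤ cHs d a * latticeConst d (deltaH d a) :=
    mul_nonneg (cHs_nonneg d ha) (latticeConst_nonneg d (deltaH_pos d ha).le)
  have hCG0 : 0 ≤ A' + cHs d a * latticeConst d (deltaH d a)
      * (((cG0 d * cKL d (d - 2) + cSplit d a) * Real.exp (2 * deltaU d a)
          + cFar d a * Real.exp (4 * deltaU d a) / deltaU d a ^ 2) * latticeConst d (deltaU d a / 4)) :=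
    add_nonneg hA0 (mul_nonneg hCH0 (mul_nonneg (supConstG_nonneg d ha)
      (latticeConst_nonneg d (div_nonneg (deltaU_pos d ha).le zero_le_four))))
  have hK0 : (0 : ℝ) ≤ ((N : ℝ)⁻¹ - c)⁻¹ := by
    have h := NNReal.coe_lt_coe.2 hcN
    rw [NNReal.coe_inv] at h
    exact inv_nonneg.2 (sub_nonneg.2 h.le)
  have hul : ∀ t, |u t| ≤ (lam : ℝ) * |t| := fun t => by
    have h := abs_comp_le hu hlam t
    rwa [hu0, abs_zero, zero_add] at h
  obtain ⟨-, hDw, hEL⟩ := hσ w hw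
  -- `‖σ w‖ ≤ K₁‖w‖` from the Lipschitz letter at `0`
  have hσw : ‖σ w‖ ≤ ((N : ℝ)⁻¹ - c)⁻¹ * ‖w‖ := by
    have h0 : (0 : lp (fun _ : X d => ℝ) ∞) ∈ closedBall (0 : lp (fun _ : X d => ℝ) ∞) (((N : ℝ)⁻¹ - c) * r) :=
      mem_closedBall_self (by rw [mem_closedBall, dist_zero_right] at hw; exact (norm_nonneg w).trans hw)
    have h := hlip.dist_le_mul w hw 0 h0
    rwa [hσ0, dist_zero_right, dist_zero_right, NNReal.coe_inv, NNReal.coe_sub hcN.le, NNReal.coe_inv] at h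
  have h := abs_diff_le_of_background_eq hCG0 hP' hgrad (NNReal.coe_nonneg lam) hul hEL p μ
  rw [hDw] at h
  have hM : (0 : ℝ) ≤ ((n : ℝ) + 1)⁻¹ := by positivity
  have h3 : 2 * (lam : ℝ) * ‖σ w‖ ≤ 2 * lam * ((N : ℝ)⁻¹ - c)⁻¹ * ‖w‖ := by
    rw [mul_assoc (2 * (lam : ℝ))]
    exact mul_le_mul_of_nonneg_left hσw (by positivity)
  rw [mul_assoc]
  refine h.trans (mul_le_mul_of_nonneg_left ?_ hM)
  calc _ ≤ cHs d a * latticeConst d (deltaH d a) * ‖w‖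
        + (A' + cHs d a * latticeConst d (deltaH d a)
            * (((cG0 d * cKL d (d - 2) + cSplit d a) * Real.exp (2 * deltaU d a)
                + cFar d a * Real.exp (4 * deltaU d a) / deltaU d a ^ 2) * latticeConst d (deltaU d a / 4)))
          * (2 * lam * ((N : ℝ)⁻¹ - c)⁻¹ * ‖w‖) := add_le_add le_rfl (mul_le_mul_of_nonneg_left h3 hCG0)
    _ = _ := by ring

/-! ## §5. Toy -/

/-- Toy: the shape of §4's constant — with `C_∞ = 2`, `C_Γ′ = 3`, `2λK₁ = 1∕2` the η-gradient constant is `2 + 3·(1∕2) = 7∕2`, and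
at side `n + 1 = 4` the site-gradient of the background is at most `(7∕2)∕4 = 7∕8` per unit of `‖w‖_∞`. -/
example : (4 : ℝ)⁻¹ * (2 + 3 * (1 / 2)) = 7 / 8 := by norm_num

end Summit.QuantumFields.BalabanUV.T4Continuum.NE7b.SupBackgroundGradient

end
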